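import Summits.Schanuel.Schanuel.Theorems.DiophantineDichotomyKhovanskiiApproxTypeEvPairSumMeasure
import Summits.Schanuel.Schanuel.Theorems.DiophantineDichotomyKhovanskiiApproxTypeEvMinimalClause
import Summits.Schanuel.Schanuel.Theorems.DiophantineDichotomyKhovanskiiApproxTypeEvExpAlgClauseMeasure
import HarnessLib

/-!
# The print exponent `κ = 3` for ONE pair sum against `e^β` (`stub_pairSumCoordMeasure`)

Line `Sketch` of crux `DiophantineDichotomy.KhovanskiiApproxTypeEv` (stmt-Schanuel-14972), skeleton v10
(lead `prover-line-stmt-Schanuel-14972-c12-0`), registered stub `stub_pairSumCoordMeasure` — `--supports`.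

Leaf B of the crux (`stub_evLW_rankThreeUp`, the naive Lindemann–Weierstrass layer at rank `≥ 3`) carries the
kernel certificate `stub_pairSumMeasure` (p146020): `EvLW 3` forces the pair-sum measure with an exponent
`κ < 5/2`.  This file proves the PRINT SIDE for one coordinate, unconditionally: for algebraic `β ≠ 0` there is
`C > 0` such that for every degree budget `k`, beyond a threshold `h₀(k)`, any two clause-numbers `x, y` of
level `(k, H)` (roots of non-zero integer polynomials of degree `≤ k` and naive height `≤ H`) satisfy
`|x + y − e^β| ≥ exp(−C k³ log H)`.  Route: `x + y` carries a clause of level `(k², 4^{k²}((k+1)H)^{2k})`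
(`stub_clauseAdd`, p144679), hence an IRREDUCIBLE one of degree `m ≤ k²` and height
`≤ 2^{k²}(k²+1)·4^{k²}((k+1)H)^{2k} ≤ H^{7k}` past `H ≥ 4^k (k+1)` (`stub_minimalClause`, `levelHeight_le_pow`),
and the degree-linear one-variable measure `stub_expAlgIrredClauseMeasure` (Mahler 1932 / Ably 1994 at `m = 1`
through the landed `evLWDh` at rank 1) gives `|x + y − e^β| ≥ exp(−C m · 7k log H) ≥ exp(−7C k³ log H)`.
Everything here is proved; no named facts.
-/

noncomputable section

set_option linter.dupNamespace false -- mandated summit/sub-problem namespace (single-conjunct summit)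

namespace Summit.Schanuel.Schanuel.Cruxes.KhovanskiiApproxTypeEv.AnchoredReduction

open Polynomial

/-- Height bookkeeping: past `H ≥ 4^k (k+1)` (and `k ≥ 1`) the height of the irreducible clause of a pair sum,
`2^{k²} (k²+1) · 4^{k²}((k+1)H)^k((k+1)H)^k`, is at most `H^{7k}`. [folklore] -/
theorem irredLevelHeight_le_pow {k H : ℕ} (hk : 1 ≤ k) (hH : 4 ^ k * (k + 1) ≤ H) :
    2 ^ (k * k) * (k * k + 1) * (4 ^ (k * k) * ((k + 1) * H) ^ k * ((k + 1) * H) ^ k) ≤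
      H ^ (7 * k) := by
  have h4 : 4 ^ k ≤ H := le_trans (Nat.le_mul_of_pos_right _ (by omega)) hH
  have h2k : 2 ^ k ≤ H := le_trans (Nat.pow_le_pow_left (by norm_num) k) h4
  have hk1 : k + 1 ≤ H := le_trans (Nat.le_mul_of_pos_left _ (by positivity)) hH
  have h1 : 2 ^ (k * k) ≤ H ^ k := by
    rw [pow_mul]; exact Nat.pow_le_pow_left h2k k
  have h2 : k * k + 1 ≤ H ^ k := by
    have hkk : k * k + 1 ≤ 2 ^ k * 2 ^ k := by
      have := Nat.lt_two_pow_self (n := k)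
      nlinarith
    calc k * k + 1 ≤ 2 ^ k * 2 ^ k := hkk
      _ = 4 ^ k := by rw [← mul_pow]; norm_num
      _ ≤ H := h4
      _ ≤ H ^ k := Nat.le_self_pow (by omega) _
  have h3 : 4 ^ (k * k) * ((k + 1) * H) ^ k * ((k + 1) * H) ^ k ≤ H ^ (5 * k) :=
    levelHeight_le_pow hk hH
  calc 2 ^ (k * k) * (k * k + 1) * (4 ^ (k * k) * ((k + 1) * H) ^ k * ((k + 1) * H) ^ k)
      ≤ H ^ k * H ^ k * H ^ (5 * k) := Nat.mul_le_mul (Nat.mul_le_mul h1 h2) h3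
    _ = H ^ (7 * k) := by rw [← pow_add, ← pow_add]; ring_nf

/-- **`stub_pairSumCoordMeasure` — THE PRINT EXPONENT `κ = 3` FOR ONE PAIR SUM** (registered sub-goal of line
`Sketch`, skeleton v10; lead c12).  For algebraic `β ≠ 0` there is `C > 0` such that for every degree budget `k`,
beyond a threshold `h₀(k)`, any two clause-numbers `x, y` of level `(k, H)` satisfy
`|x + y − e^β| ≥ exp(−C k³ log H)`.  This is the printed state of the art (Mahler 1932 / Ably 1994 at `m = 1`
on the pair sum, a clause-number of degree `≤ k²` and height `≤ H^{5k}`) behind the remark "print gives `κ = 3`"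
of leaf B's certificate `stub_pairSumMeasure` (p146020), whose demand is `κ < 5/2`. [folklore] -/
theorem stub_pairSumCoordMeasure (β : ℂ) (hβ : IsAlgebraic ℚ β) (hβ0 : β ≠ 0) :
    ∃ C : ℝ, 0 < C ∧ ∀ k : ℕ, ∃ h₀ : ℕ, ∀ (H : ℕ) (x y : ℂ), h₀ ≤ H →
      (∃ P : Polynomial ℤ, P ≠ 0 ∧ P.natDegree ≤ k ∧ (∀ l, |P.coeff l| ≤ (H : ℤ)) ∧
        Polynomial.aeval x P = 0) →
      (∃ P : Polynomial ℤ, P ≠ 0 ∧ P.natDegree ≤ k ∧ (∀ l, |P.coeff l| ≤ (H : ℤ)) ∧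
        Polynomial.aeval y P = 0) →
      Real.exp (-(C * (k : ℝ) ^ (3 : ℝ) * Real.log H)) ≤ ‖x + y - Complex.exp β‖ := by
  obtain ⟨C, hC, hall⟩ := stub_expAlgIrredClauseMeasure β hβ hβ0
  refine ⟨7 * C, by positivity, fun k => ?_⟩
  -- degree budget `k = 0` is vacuous
  rcases Nat.eq_zero_or_pos k with hk0 | hk
  · refine ⟨0, fun H x y _ hx _ => ?_⟩
    have := one_le_budget_of_clause hx
    omega
  obtain ⟨H₀, hH₀⟩ := hall (k * k)
  refine ⟨max H₀ (4 ^ k * (k + 1)), fun H x y hH hx hy => ?_⟩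
  have hH0 : H₀ ≤ H := le_trans (le_max_left _ _) hH
  have hH4 : 4 ^ k * (k + 1) ≤ H := le_trans (le_max_right _ _) hH
  have hH2 : 2 ≤ H := le_trans (by
    calc 2 ≤ 4 ^ k := le_trans (by norm_num) (Nat.pow_le_pow_right (by norm_num) hk)
      _ ≤ 4 ^ k * (k + 1) := Nat.le_mul_of_pos_right _ (by omega)) hH4
  have hH1r : (1 : ℝ) < H := by exact_mod_cast hH2
  have hlogH : 0 < Real.log H := Real.log_pos hH1r
  -- the clause of `x + y` and its irreducible replacement
  obtain ⟨S, hS0, hSdeg, hSH, hSroot⟩ := stub_clauseAdd hx hy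
  set L : ℕ := 4 ^ (k * k) * ((k + 1) * H) ^ k * ((k + 1) * H) ^ k with hL
  obtain ⟨R, hirr, hRroot, hR1, hRdeg, hRcoef⟩ :=
    stub_minimalClause (x + y) (k * k) L S hS0 hSdeg hSH hSroot
  set L' : ℕ := 2 ^ (k * k) * (k * k + 1) * L with hL'
  have hL'pow : L' ≤ H ^ (7 * k) := irredLevelHeight_le_pow hk hH4
  -- `H ≤ L ≤ L'`
  have hHL : H ≤ L := by
    have h1 : 1 ≤ 4 ^ (k * k) := Nat.one_le_pow _ _ (by norm_num)
    have h2 : H ≤ ((k + 1) * H) ^ k := by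
      calc H ≤ (k + 1) * H := Nat.le_mul_of_pos_left _ (by omega)
        _ ≤ ((k + 1) * H) ^ k := Nat.le_self_pow (by omega) _
    have h3 : 1 ≤ ((k + 1) * H) ^ k := le_trans (by omega) h2
    calc H ≤ ((k + 1) * H) ^ k := h2
      _ = 1 * ((k + 1) * H) ^ k * 1 := by ring
      _ ≤ 4 ^ (k * k) * ((k + 1) * H) ^ k * ((k + 1) * H) ^ k :=
        Nat.mul_le_mul (Nat.mul_le_mul h1 le_rfl) h3
  have hLL' : L ≤ L' := by
    have h1 : 1 ≤ 2 ^ (k * k) * (k * k + 1) := Nat.one_le_iff_ne_zero.2 (by positivity)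
    calc L = 1 * L := (one_mul _).symm
      _ ≤ 2 ^ (k * k) * (k * k + 1) * L := Nat.mul_le_mul_right _ h1
  have hHL' : H ≤ L' := hHL.trans hLL'
  have hL'0 : H₀ ≤ L' := hH0.trans hHL'
  have hL'pos : (0 : ℝ) < L' := by exact_mod_cast (lt_of_lt_of_le (by omega) hHL' : 0 < L')
  have hlogL' : Real.log L' ≤ 7 * k * Real.log H := by
    have h1 : (L' : ℝ) ≤ (H : ℝ) ^ (7 * k) := by exact_mod_cast hL'pow
    calc Real.log L' ≤ Real.log ((H : ℝ) ^ (7 * k)) := Real.log_le_log hL'pos h1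
      _ = 7 * k * Real.log H := by rw [Real.log_pow]; push_cast; ring
  have hRcoef' : ∀ l, |R.coeff l| ≤ (L' : ℤ) := fun l => by
    have := hRcoef l
    simpa [hL'] using this
  -- the one-variable measure at level `(k², L')`
  have hmain := hH₀ L' (x + y) R hL'0 hirr hRroot hRdeg hRcoef'
  refine le_trans (Real.exp_le_exp.2 (neg_le_neg ?_)) hmain
  -- `C · deg R · log L' ≤ 7 C k³ log H`
  have hm : (R.natDegree : ℝ) ≤ (k : ℝ) * k := by exact_mod_cast hRdeg
  have hlogL'0 : 0 ≤ Real.log L' :=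
    Real.log_nonneg (by exact_mod_cast (le_trans (by omega) hHL' : 1 ≤ L'))
  have hk3 : (k : ℝ) ^ (3 : ℝ) = (k : ℝ) * k * k := by
    rw [show (3 : ℝ) = ((3 : ℕ) : ℝ) by norm_num, Real.rpow_natCast]
    ring
  rw [hk3]
  calc C * (R.natDegree : ℝ) * Real.log L'
      ≤ C * ((k : ℝ) * k) * (7 * k * Real.log H) := by
        apply mul_le_mul (mul_le_mul_of_nonneg_left hm hC.le) hlogL' hlogL'0
        positivity
    _ = 7 * C * ((k : ℝ) * k * k) * Real.log H := by ring

end Summit.Schanuel.Schanuel.Cruxes.KhovanskiiApproxTypeEv.AnchoredReduction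

end
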